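import Summits.BirchSwinnertonDyer.BirchSwinnertonDyer.Theorems.ThetaPartnerAtTwoSignedKatoUpToAtTwoOffTwo
import Summits.BirchSwinnertonDyer.BirchSwinnertonDyer.Theorems.ThetaPartnerAtTwoSignedKatoUpToAtTwoOffTwoPackage
import Summits.BirchSwinnertonDyer.BirchSwinnertonDyer.Theorems.ThetaPartnerAtTwoSignedKatoUpToAtTwoOffTwoFinite
import Literature.NumberTheory.EllipticCurves.Kato2004.EulerSystemBoundFineSelmerTwo
import HarnessLib

/-!
# Route `ThetaPartnerAtTwo` (TP2), crux K3 `SignedKatoDivisibilityUpToAtTwo` (item stmt-BirchSwinnertonDyer-20308),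
# line `colemanrat` v3: **K3 BY NAME MODULO PRINT** — from the ONE `p = 2` research input (a `2`-adic
# Coleman–Poitou–Tate package) and two PUBLISHED facts by name: Kato Thm. 13.4 (2) at `p = 2`
# (`Kato2004.thm13_4_two_lengthAt_fineSelmerDual_le_of_isEulerSystemClassTwo`, p570468) and Gross–Zagier–Kolyvagin
# (`rank_eq_analyticRank_of_analyticRank_le_one`); plus the registered stub (K2) `stub_katoBoundTwo` VERBATIM from
# the Kato fact (lead `bsd-wall-tp2-p2x`)

HONEST FRAMING (cell `bsd-wall`): THEOREMS ONLY — no definition, no named fact, no instance, no `sorry`; every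
theorem is CONDITIONAL on the displayed hypotheses (two def:Prop Literature facts without `_holds`, one research
package at `p = 2`); closes no item (`proof.conditional`); BSD is NOT proved by any of this.

## What is proved

* `stub_katoBoundTwo_of_thm13_4_two` — the registered stub (K2) of `Cruxes/SignedKatoDivisibilityUpToAtTwo/Lines/
  colemanrat.lean` v3, VERBATIM, from the Literature fact (unfolding `Kato2004.IsEulerSystemClassTwo`): (K2) is
  PUB by name.
* `signedKatoDivisibilityUpToAtTwo_of_colemanPackageTwo_of_pub` — **K3 by name** from `h134` (Kato 13.4 (2) at 2),
  `h17` (GZK) and `hPkg`: for every habitat datum, dual datum `D` (torsion) and height-one `𝔭 ∌ 2`, SOME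
  `P ≤ Λ`, injective `col : 𝐇¹_Γ(T₂E) → P`, `j : P → X⁺`, `k : X⁺ → X₀` exact at `P` and `X⁺`, and a non-zero
  genuine `2`-adic Euler-system class `s` with `v_𝔭(col s) ≤ v_𝔭(L♭)` — Kobayashi Thm. 6.2/6.3/7.3 ∕ Sprung 2012
  Prop. 7.19 + Def. 6.1 READ AT `p = 2` in the weakest form (no surjectivity of `Col⁺`, no integrality of `z`, no
  finiteness clause — the latter is `h17`, file `…OffTwoFinite`). THIS is the crux's research content; the rest is
  print + kernel.

References: [Kato2004Asterisque] Thm. 13.4 (2) (p. 226), Thm. 12.5 (3) (p. 222); [Kobayashi2003] Thm. 6.2–6.3,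
7.3 (pp. 11–13); [Sprung2012] Def. 6.1 (p. 1495), §7 (pp. 1499–1504); [Darmon2004] Thm. 3.22.
-/

set_option autoImplicit false
-- the Theorems namespace of this sub repeats the summit name by design (D-0017 nested layout)
set_option linter.dupNamespace false

noncomputable section

open scoped Classical MatrixGroups ModularForm NumberField

open CongruenceSubgroup WeierstrassCurve Field IsDedekindDomain
  Literature.NumberTheory.GaloisRepresentations
  Literature.NumberTheory.EllipticCurves Literature.NumberTheory.EllipticCurves.ModularForms
  Literature.NumberTheory.EllipticCurves.Module Literature.NumberTheory.EllipticCurves.Rank1Residual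
  Literature.NumberTheory.EllipticCurves.Kobayashi2003 Literature.NumberTheory.EllipticCurves.Kato2004
  Literature.NumberTheory.EllipticCurves.Kato2004.EulerSystemValues ZpExtension
  Summit.BirchSwinnertonDyer.Rank1Residual.Supersingular
  Summit.BirchSwinnertonDyer.BirchSwinnertonDyer.Theses.ThetaPartnerAtTwo

namespace Summit.BirchSwinnertonDyer.BirchSwinnertonDyer.Theorems

namespace SignedKatoOffTwo

/-- **Stub (K2) `stub_katoBoundTwo` VERBATIM from Kato Thm. 13.4 (2) at `p = 2` BY NAME** (the registered
signature, with the Euler-system-class predicate inlined, is the fact after unfolding `Kato2004.IsEulerSystemClassTwo`).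
CONDITIONAL on the named fact (no `_holds`: Kato §13, size XL). [cite: Kato2004Asterisque, Thm. 13.4 (2) (p. 226)] -/
theorem stub_katoBoundTwo_of_thm13_4_two
    (h134 : Kato2004.thm13_4_two_lengthAt_fineSelmerDual_le_of_isEulerSystemClassTwo) :
    ∀ (W : WeierstrassCurve ℚ) [W.IsElliptic], ¬ W.HasCM →
      ∀ [ContinuousSMul ℤ_[2] (W.tateModule 2)] [Module.Free ℤ_[2] (W.tateModule 2)]
        [Module.Finite ℤ_[2] (W.tateModule 2)]
        (κ : ZpExtension ℚ 2) (γ : Field.absoluteGaloisGroup ℚ) (hκ : κ.IsCyclotomic), κ.IsTopGenerator γ →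
      ∀ (I : Kato2004.IwasawaH1Data W 2 κ γ) (Y : W.FineSelmerDualData κ γ) (s : I.H),
        (∃ (S : Set (HeightOneSpectrum (𝓞 ℚ))) (_ : S.Finite)
            (z : ∀ (k : ℕ) (r : (cyclotomicLevelsRat 2 S).Ideals),
              H1 (tateRep W 2) ((cyclotomicLevelsRat 2 S).level k r.1)),
            IsEulerSystem (cyclotomicLevelsRat 2 S) (tateRep W 2) 2 z ∧
            (∀ (k : ℕ) (r : (cyclotomicLevelsRat 2 S).Ideals),
              z k r ∈ integralH1 (tateRep W 2) 2 ((cyclotomicLevelsRat 2 S).level k r.1)) ∧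
            ∀ n : ℕ, I.proj n s =
              Kato2004.levelToLayerTwo W hκ S n (z (n + 2) (cyclotomicLevelsRat 2 S).idealOne)) →
        s ≠ 0 →
        ∀ 𝔭 : PrimeSpectrum (IwasawaAlgebra 2), 𝔭.asIdeal.height = 1 →
          PowerSeries.C (2 : ℤ_[2]) ∉ 𝔭.asIdeal →
          lengthAt (IwasawaAlgebra 2) Y.X 𝔭 ≤
            lengthAt (IwasawaAlgebra 2) (I.H ⧸ Submodule.span (IwasawaAlgebra 2) {s}) 𝔭 :=
  fun W _ hcm _ _ _ κ γ hκ hγ I Y s hES hs0 𝔭 h𝔭 hp𝔭 ↦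
    h134 W hcm κ γ hκ hγ I Y s ((Kato2004.isEulerSystemClassTwo_iff W hκ I s).mpr hES) hs0 𝔭 h𝔭 hp𝔭

/-- **K3 `SignedKatoDivisibilityUpToAtTwo` BY NAME, MODULO PRINT, from ONE `2`-adic Coleman–Poitou–Tate package.**
Granted Kato Thm. 13.4 (2) at `p = 2` (`h134`) and Gross–Zagier–Kolyvagin (`h17`), if for every habitat datum,
dual datum `D` of `Sel⁺(E/ℚ_∞)` (torsion) and height-one `𝔭 ∌ 2` there are pinned `I`, `Y`, a submodule `P ≤ Λ`, an
injective `col : 𝐇¹_Γ(T₂E) → P`, `j : P → X⁺`, `k : X⁺ → X₀` exact at `P` and at `X⁺`, and a non-zero genuine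
`2`-adic Euler-system class `s` with `ℓ_𝔭(Λ/(col s)) ≤ ℓ_𝔭(Λ/(L♭))` (Kobayashi (7.21) + Thm. 6.3 ∕ Sprung 2012
(3) + Def. 6.1 at `p = 2`, per-`𝔭` choice of Kato's `(c,d)`), then K3 holds: finiteness of `ℓ_𝔭(𝐇¹/Λs)` from
`h17` (`lengthAt_quotient_span_ne_top_of_gzk`), stub (C2) by `colemanLengthTwo_of_colemanPackageTwo`, stub (K2) by
`stub_katoBoundTwo_of_thm13_4_two`, the local form by `offTwo_of_colemanLengthTwo_of_katoBoundTwo`, K3 by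
`signedKatoDivisibilityUpToAtTwo_of_offTwo`. [cite: Kato2004Asterisque, Thm. 13.4 (2) (p. 226)]
[cite: Kobayashi2003, Thm. 6.3 (p. 11), Thm. 7.3 (7.21) (p. 13)] [cite: Sprung2012, Def. 6.1 (p. 1495) and proof of Thm. 7.14 (p. 1504)]
[cite: Darmon2004, Thm. 3.22] -/
theorem signedKatoDivisibilityUpToAtTwo_of_colemanPackageTwo_of_pub
    (h134 : Kato2004.thm13_4_two_lengthAt_fineSelmerDual_le_of_isEulerSystemClassTwo)
    (h17 : rank_eq_analyticRank_of_analyticRank_le_one)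
    (hPkg : ∀ (W : WeierstrassCurve ℚ) [W.IsElliptic] [W.IsGloballyMinimal],
      ¬ W.HasCM → W.analyticRank = 0 → GoodSS W 2 → W.frobeniusTrace 2 = 0 →
      ∀ (κ : ZpExtension ℚ 2) (γ : Field.absoluteGaloisGroup ℚ) (hκ : κ.IsCyclotomic),
        κ.IsTopGenerator γ → IsCyclotomicVariable 2 γ →
        ∀ [NeZero (W.conductorNorm ℤ)] (f : CuspForm (Gamma0 (W.conductorNorm ℤ)) 2),
          IsNewformOf W f → ∀ (ϖ : ℚ), (ϖ : ℝ) * W.realPeriodRat = plusPeriod f →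
        ∀ (Lplus Lminus : IwasawaAlgebra 2), IsPollackPair f 2 Lplus Lminus →
        ∀ (D : SignedSelmerDualData W κ γ 1) [ContinuousSMul ℤ_[2] (W.tateModule 2)]
          [Module.Free ℤ_[2] (W.tateModule 2)] [Module.Finite ℤ_[2] (W.tateModule 2)],
          Module.IsTorsion (IwasawaAlgebra 2) D.X →
          ∀ 𝔭 : PrimeSpectrum (IwasawaAlgebra 2), 𝔭.asIdeal.height = 1 →
            PowerSeries.C (2 : ℤ_[2]) ∉ 𝔭.asIdeal →
          ∃ (I : Kato2004.IwasawaH1Data W 2 κ γ) (Y : W.FineSelmerDualData κ γ)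
            (P : Submodule (IwasawaAlgebra 2) (IwasawaAlgebra 2))
            (col : I.H →ₗ[IwasawaAlgebra 2] P) (j : P →ₗ[IwasawaAlgebra 2] D.X)
            (k : D.X →ₗ[IwasawaAlgebra 2] Y.X) (s : I.H),
            Function.Injective col ∧ Function.Exact col j ∧ Function.Exact j k ∧
            Kato2004.IsEulerSystemClassTwo W hκ I s ∧ s ≠ 0 ∧
            lengthAt (IwasawaAlgebra 2) (IwasawaAlgebra 2 ⧸ Ideal.span {(P.subtype (col s))}) 𝔭 ≤
              lengthAt (IwasawaAlgebra 2) (IwasawaAlgebra 2 ⧸ Ideal.span {kobayashiL 1 Lplus Lminus}) 𝔭) :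
    SignedKatoDivisibilityUpToAtTwo := by
  refine signedKatoDivisibilityUpToAtTwo_of_offTwo
    (offTwo_of_colemanLengthTwo_of_katoBoundTwo
      (colemanLengthTwo_of_colemanPackageTwo
        fun W _ _ hcm hr hss ha κ γ hκ hγ hcv _ f hf ϖ hϖ Lplus Lminus hPP D _ _ _ hX 𝔭 h𝔭 hp𝔭 ↦ ?_)
      (stub_katoBoundTwo_of_thm13_4_two h134))
  obtain ⟨I, Y, P, col, j, k, s, hcol, hcj, hjk, hES, hs0, hdiv⟩ :=
    hPkg W hcm hr hss ha κ γ hκ hγ hcv f hf ϖ hϖ Lplus Lminus hPP D hX 𝔭 h𝔭 hp𝔭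
  exact ⟨I, Y, P, col, j, k, s, hcol, hcj, hjk, (Kato2004.isEulerSystemClassTwo_iff W hκ I s).mp hES, hs0,
    lengthAt_quotient_span_ne_top_of_gzk h17 hr hκ hγ I hs0 𝔭 (le_of_eq h𝔭), hdiv⟩

/-! ## Appended (lead tp2-p2x g0, 2026-08-27): injectivity of the Coleman map is NOT part of the research input —
it follows at `p = 2` from GZK (`rank_Λ 𝐇¹ ≤ 1`, torsion free) and `col s ≠ 0` (Kato (17.13.2)); so the package is
Kobayashi's (7.20) — Poitou–Tate exactness WITHOUT injectivity — plus the zeta-value clause -/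

/-- **K3 BY NAME, MODULO PRINT, from the WEAKER package without `Function.Injective col`** (Kobayashi's (7.20) — the
Poitou–Tate sequence `𝐇¹ → P → X⁺ → X₀` exact at `P` and at `X⁺`, NOT (7.21) — plus a non-zero genuine `2`-adic Euler-
system class `s` with `ℓ_𝔭(Λ/(col s)) ≤ ℓ_𝔭(Λ/(L♭))`, per habitat datum and height-one `𝔭 ∌ 2`). Injectivity of `col`
(Kobayashi Thm. 7.3 i), printed for `p` odd from the FREENESS of `𝐇¹` = Kato 12.4 (3), which assumes `p ≠ 2`) is derived here
instead from `h17`: `rank_Λ 𝐇¹_Γ(T₂E) ≤ 1` (GZK ⇒ (R0) ⇒ `IwasawaH1Data.rank_le_one_of_rank_integralH1_le_one`), `𝐇¹` torsion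
free (`IwasawaH1Data.isTorsionFree`) and `col s ≠ 0` (forced by the valuation clause, `L♭ ≠ 0`) give injectivity by Kato's
(17.13.2) argument (`Module.injective_of_rank_le_one`). [cite: Kato2004Asterisque, §17.13 (17.13.2) (p. 279), Thm. 13.4 (2) (p. 226)]
[cite: Kobayashi2003, (7.20) (p. 12), Thm. 6.3 (p. 11)] [cite: Sprung2012, Def. 6.1 (p. 1495)] [cite: Darmon2004, Thm. 3.22] -/
theorem signedKatoDivisibilityUpToAtTwo_of_poitouTatePackageTwo_of_pub
    (h134 : Kato2004.thm13_4_two_lengthAt_fineSelmerDual_le_of_isEulerSystemClassTwo)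
    (h17 : rank_eq_analyticRank_of_analyticRank_le_one)
    (hPT : ∀ (W : WeierstrassCurve ℚ) [W.IsElliptic] [W.IsGloballyMinimal],
      ¬ W.HasCM → W.analyticRank = 0 → GoodSS W 2 → W.frobeniusTrace 2 = 0 →
      ∀ (κ : ZpExtension ℚ 2) (γ : Field.absoluteGaloisGroup ℚ) (hκ : κ.IsCyclotomic),
        κ.IsTopGenerator γ → IsCyclotomicVariable 2 γ →
        ∀ [NeZero (W.conductorNorm ℤ)] (f : CuspForm (Gamma0 (W.conductorNorm ℤ)) 2),
          IsNewformOf W f → ∀ (ϖ : ℚ), (ϖ : ℝ) * W.realPeriodRat = plusPeriod f →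
        ∀ (Lplus Lminus : IwasawaAlgebra 2), IsPollackPair f 2 Lplus Lminus →
        ∀ (D : SignedSelmerDualData W κ γ 1) [ContinuousSMul ℤ_[2] (W.tateModule 2)]
          [Module.Free ℤ_[2] (W.tateModule 2)] [Module.Finite ℤ_[2] (W.tateModule 2)],
          Module.IsTorsion (IwasawaAlgebra 2) D.X →
          ∀ 𝔭 : PrimeSpectrum (IwasawaAlgebra 2), 𝔭.asIdeal.height = 1 →
            PowerSeries.C (2 : ℤ_[2]) ∉ 𝔭.asIdeal →
          ∃ (I : Kato2004.IwasawaH1Data W 2 κ γ) (Y : W.FineSelmerDualData κ γ)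
            (P : Submodule (IwasawaAlgebra 2) (IwasawaAlgebra 2))
            (col : I.H →ₗ[IwasawaAlgebra 2] P) (j : P →ₗ[IwasawaAlgebra 2] D.X)
            (k : D.X →ₗ[IwasawaAlgebra 2] Y.X) (s : I.H),
            Function.Exact col j ∧ Function.Exact j k ∧
            Kato2004.IsEulerSystemClassTwo W hκ I s ∧ s ≠ 0 ∧
            lengthAt (IwasawaAlgebra 2) (IwasawaAlgebra 2 ⧸ Ideal.span {(P.subtype (col s))}) 𝔭 ≤
              lengthAt (IwasawaAlgebra 2) (IwasawaAlgebra 2 ⧸ Ideal.span {kobayashiL 1 Lplus Lminus}) 𝔭) :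
    SignedKatoDivisibilityUpToAtTwo := by
  refine signedKatoDivisibilityUpToAtTwo_of_colemanPackageTwo_of_pub h134 h17
    fun W _ _ hcm hr hss ha κ γ hκ hγ hcv _ f hf ϖ hϖ Lplus Lminus hPP D _ _ _ hX 𝔭 h𝔭 hp𝔭 ↦ ?_
  obtain ⟨I, Y, P, col, j, k, s, hcj, hjk, hES, hs0, hdiv⟩ :=
    hPT W hcm hr hss ha κ γ hκ hγ hcv f hf ϖ hϖ Lplus Lminus hPP D hX 𝔭 h𝔭 hp𝔭
  refine ⟨I, Y, P, col, j, k, s, ?_, hcj, hjk, hES, hs0, hdiv⟩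
  -- `L♭ ≠ 0`, so `ℓ_𝔭(Λ/(L♭)) < ⊤`, so `ℓ_𝔭(Λ/(col s)) < ⊤`, so `col s ≠ 0`
  have hL : kobayashiL 1 Lplus Lminus ≠ 0 := by rw [kobayashiL, if_pos rfl]; exact hPP.2.1
  have hLtop : lengthAt (IwasawaAlgebra 2)
      (IwasawaAlgebra 2 ⧸ Ideal.span {kobayashiL 1 Lplus Lminus}) 𝔭 ≠ ⊤ :=
    lengthAt_ne_top_of_isTorsionBy hL
      ((Module.isTorsionBy_quotient_iff _ _).mpr fun y ↦ by
        rw [smul_eq_mul]; exact Ideal.mul_mem_right y _ (Ideal.mem_span_singleton_self _))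
      𝔭 (le_of_eq h𝔭)
  have hcs : (P.subtype (col s) : IwasawaAlgebra 2) ≠ 0 := by
    intro h0
    have htop : lengthAt (IwasawaAlgebra 2) (IwasawaAlgebra 2 ⧸ Ideal.span {(P.subtype (col s))}) 𝔭 = ⊤ := by
      rw [h0]
      refine UniversalToricDescentCharIdealVacuity.lengthAt_eq_top_of_torsionFree
        (m := Submodule.Quotient.mk (1 : IwasawaAlgebra 2)) (fun r hr ↦ ?_) 𝔭 ?_
      · rw [← Submodule.Quotient.mk_smul, Submodule.Quotient.mk_eq_zero, smul_eq_mul, mul_one,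
          Ideal.mem_span_singleton] at hr
        exact zero_dvd_iff.mp hr
      · intro hbot
        have : 𝔭.asIdeal.height = 0 := by rw [hbot]; exact Ideal.height_bot
        rw [h𝔭] at this
        exact one_ne_zero this
    exact hLtop (le_antisymm le_top (htop ▸ hdiv))
  -- GZK: `rank_Λ 𝐇¹ ≤ 1`; `𝐇¹` torsion free; Kato (17.13.2)
  obtain ⟨hrank, hsha⟩ := h17 W (by rw [hr]; exact zero_le_one)
  have h0 : W.mordellWeilRank = 0 := by rw [hrank, hr]
  haveI : Finite W.toAffine.Point := W.finite_point_of_rank_zero h0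
  haveI : Finite W.sha := hsha
  haveI : Finite (AddCommGroup.primaryComponent W.sha 2) := inferInstance
  have hrank1 : Module.rank (IwasawaAlgebra 2) I.H ≤ 1 :=
    I.rank_le_one_of_rank_integralH1_le_one hκ hγ (IntegralH1RankZero.rank_integralH1_layerZero_le_one W 2 κ)
  haveI : Module.IsTorsionFree (IwasawaAlgebra 2) I.H := I.isTorsionFree hγ
  refine injective_of_rank_le_one hrank1 col s fun a ha ↦ ?_
  have ha' : a * (P.subtype (col s) : IwasawaAlgebra 2) = 0 := by
    rw [← smul_eq_mul, ← map_smul, ha, map_zero]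
  exact (mul_eq_zero.mp ha').resolve_right hcs

/-! ## Appended (lead tp2-p2x g0): the WEAKEST package — only the COMPLEX property `j ∘ col = 0` and the COVER
property `ker(X⁺ → X₀) ≤ j(P)`; injectivity from GZK; finiteness from GZK; Kato's bound by name -/

/-- A cyclic quotient `Λ/(g)` whose local length at a height-one prime is bounded by that of `Λ/(L)`, `L ≠ 0`, has
`g ≠ 0` (`ℓ_𝔭(Λ/(0)) = ⊤`, `ℓ_𝔭(Λ/(L)) < ⊤`). [folklore] -/
theorem ne_zero_of_lengthAt_quotient_span_le {p : ℕ} [Fact p.Prime] {g L : IwasawaAlgebra p} (hL : L ≠ 0)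
    (𝔭 : PrimeSpectrum (IwasawaAlgebra p)) (h𝔭 : 𝔭.asIdeal.height = 1)
    (h : lengthAt (IwasawaAlgebra p) (IwasawaAlgebra p ⧸ Ideal.span {g}) 𝔭 ≤
      lengthAt (IwasawaAlgebra p) (IwasawaAlgebra p ⧸ Ideal.span {L}) 𝔭) : g ≠ 0 := by
  have hLtop : lengthAt (IwasawaAlgebra p) (IwasawaAlgebra p ⧸ Ideal.span {L}) 𝔭 ≠ ⊤ :=
    lengthAt_ne_top_of_isTorsionBy hL
      ((Module.isTorsionBy_quotient_iff _ _).mpr fun y ↦ by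
        rw [smul_eq_mul]; exact Ideal.mul_mem_right y _ (Ideal.mem_span_singleton_self _))
      𝔭 (le_of_eq h𝔭)
  intro h0
  have htop : lengthAt (IwasawaAlgebra p) (IwasawaAlgebra p ⧸ Ideal.span {g}) 𝔭 = ⊤ := by
    rw [h0]
    refine UniversalToricDescentCharIdealVacuity.lengthAt_eq_top_of_torsionFree
      (m := Submodule.Quotient.mk (1 : IwasawaAlgebra p)) (fun r hr ↦ ?_) 𝔭 ?_
    · rw [← Submodule.Quotient.mk_smul, Submodule.Quotient.mk_eq_zero, smul_eq_mul, mul_one,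
        Ideal.mem_span_singleton] at hr
      exact zero_dvd_iff.mp hr
    · intro hbot
      have : 𝔭.asIdeal.height = 0 := by rw [hbot]; exact Ideal.height_bot
      rw [h𝔭] at this
      exact one_ne_zero this
  exact hLtop (le_antisymm le_top (htop ▸ h))

/-- **Injectivity of the Coleman map at `p = 2` from Gross–Zagier–Kolyvagin** (Kato (17.13.2) instead of the
freeness Thm. 12.4 (3), which is printed for `p ≠ 2`): in analytic rank `0`, every `Λ`-linear map
`col : 𝐇¹_Γ(T_pW) → P ≤ Λ` with a value `col s` that is non-zero in `Λ` is injective — `rank_Λ 𝐇¹ ≤ 1` (`h17` ⇒ (R0)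
⇒ `rank_le_one_of_rank_integralH1_le_one`), `𝐇¹` torsion free (`isTorsionFree`), `Λ` a domain.
[cite: Kato2004Asterisque, §17.13 (17.13.2) (p. 279), Thm. 12.4 (2) (p. 221)] [cite: Darmon2004, Thm. 3.22] -/
theorem injective_col_of_gzk (h17 : rank_eq_analyticRank_of_analyticRank_le_one)
    {W : WeierstrassCurve ℚ} [W.IsElliptic] (hr : W.analyticRank = 0) {p : ℕ} [Fact p.Prime]
    [ContinuousSMul ℤ_[p] (W.tateModule p)] {κ : ZpExtension ℚ p} {γ : Field.absoluteGaloisGroup ℚ}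
    (hκ : κ.IsCyclotomic) (hγ : κ.IsTopGenerator γ) (I : Kato2004.IwasawaH1Data W p κ γ)
    {P : Submodule (IwasawaAlgebra p) (IwasawaAlgebra p)} (col : I.H →ₗ[IwasawaAlgebra p] P) {s : I.H}
    (hcs : (P.subtype (col s) : IwasawaAlgebra p) ≠ 0) : Function.Injective col := by
  obtain ⟨hrank, hsha⟩ := h17 W (by rw [hr]; exact zero_le_one)
  have h0 : W.mordellWeilRank = 0 := by rw [hrank, hr]
  haveI : Finite W.toAffine.Point := W.finite_point_of_rank_zero h0
  haveI : Finite W.sha := hsha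
  haveI : Finite (AddCommGroup.primaryComponent W.sha p) := inferInstance
  have hrank1 : Module.rank (IwasawaAlgebra p) I.H ≤ 1 :=
    I.rank_le_one_of_rank_integralH1_le_one hκ hγ (IntegralH1RankZero.rank_integralH1_layerZero_le_one W p κ)
  haveI : Module.IsTorsionFree (IwasawaAlgebra p) I.H := I.isTorsionFree hγ
  refine injective_of_rank_le_one hrank1 col s fun a ha ↦ ?_
  have ha' : a * (P.subtype (col s) : IwasawaAlgebra p) = 0 := by
    rw [← smul_eq_mul, ← map_smul, ha, map_zero]
  exact (mul_eq_zero.mp ha').resolve_right hcs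

/-- **K3 BY NAME, MODULO PRINT, from the WEAKEST package: `j ∘ col = 0` and `ker(X⁺ → X₀) ≤ j(P)` only.** Granted
Kato Thm. 13.4 (2) at `p = 2` (`h134`) and Gross–Zagier–Kolyvagin (`h17`), K3 follows if for every habitat datum, dual
datum `D` of `Sel⁺(E/ℚ_∞)` (torsion) and height-one `𝔭 ∌ 2` there are pinned `I`, `Y`, a submodule `P ≤ Λ`, `Λ`-linear
`col : 𝐇¹_Γ(T₂E) → P`, `j : P → X⁺`, `k : X⁺ → X₀` with (a) `j (col x) = 0` for all `x` — RECIPROCITY: global classes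
pair to zero with `Sel⁺` (the complex property of Kobayashi's (7.17)/(7.20)), (b) `ker k ≤ range j` — COVER: a character
of `Sel⁺` vanishing on `Sel⁰` factors through the local quotient `Sel⁺/Sel⁰ ↪ E⁺(k_∞) ⊗ ℚ₂/ℤ₂`, whose dual maps INTO
`Λ` through `Col⁺` (Kobayashi Thm. 6.2 as an injection, local Tate duality; no surjectivity), and (c) a non-zero genuine
`2`-adic Euler-system class `s` with `ℓ_𝔭(Λ/(col s)) ≤ ℓ_𝔭(Λ/(L♭))` (Kobayashi Thm. 6.3 ∕ Sprung Def. 6.1 at 2 for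
Kato's `(c,d)`-class with `μ_{c,d} ∉ 𝔭`). NOT needed: injectivity of `col` (`injective_col_of_gzk`), surjectivity of
`Col⁺`, the deep half `ker j ≤ range col` of Poitou–Tate, integrality of Kato's `z_γ`, `ℓ_𝔭(𝐇¹/Λs) < ⊤`
(`lengthAt_quotient_span_ne_top_of_gzk`). Chain: `fourTerm_lengthAt_le_of_comp_eq_zero` ⇒ (C2) ⇒
`offTwo_of_colemanLengthTwo_of_katoBoundTwo` with (K2) from `h134` ⇒ `signedKatoDivisibilityUpToAtTwo_of_offTwo`.
[cite: Kobayashi2003, (7.17)–(7.20) (p. 12), Thm. 6.2–6.3 (p. 11)] [cite: Kato2004Asterisque, Thm. 13.4 (2) (p. 226), §17.13 (p. 279)]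
[cite: Sprung2012, Def. 6.1 (p. 1495)] [cite: Darmon2004, Thm. 3.22] -/
theorem signedKatoDivisibilityUpToAtTwo_of_weakPackageTwo_of_pub
    (h134 : Kato2004.thm13_4_two_lengthAt_fineSelmerDual_le_of_isEulerSystemClassTwo)
    (h17 : rank_eq_analyticRank_of_analyticRank_le_one)
    (hW : ∀ (W : WeierstrassCurve ℚ) [W.IsElliptic] [W.IsGloballyMinimal],
      ¬ W.HasCM → W.analyticRank = 0 → GoodSS W 2 → W.frobeniusTrace 2 = 0 →
      ∀ (κ : ZpExtension ℚ 2) (γ : Field.absoluteGaloisGroup ℚ) (hκ : κ.IsCyclotomic),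
        κ.IsTopGenerator γ → IsCyclotomicVariable 2 γ →
        ∀ [NeZero (W.conductorNorm ℤ)] (f : CuspForm (Gamma0 (W.conductorNorm ℤ)) 2),
          IsNewformOf W f → ∀ (ϖ : ℚ), (ϖ : ℝ) * W.realPeriodRat = plusPeriod f →
        ∀ (Lplus Lminus : IwasawaAlgebra 2), IsPollackPair f 2 Lplus Lminus →
        ∀ (D : SignedSelmerDualData W κ γ 1) [ContinuousSMul ℤ_[2] (W.tateModule 2)]
          [Module.Free ℤ_[2] (W.tateModule 2)] [Module.Finite ℤ_[2] (W.tateModule 2)],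
          Module.IsTorsion (IwasawaAlgebra 2) D.X →
          ∀ 𝔭 : PrimeSpectrum (IwasawaAlgebra 2), 𝔭.asIdeal.height = 1 →
            PowerSeries.C (2 : ℤ_[2]) ∉ 𝔭.asIdeal →
          ∃ (I : Kato2004.IwasawaH1Data W 2 κ γ) (Y : W.FineSelmerDualData κ γ)
            (P : Submodule (IwasawaAlgebra 2) (IwasawaAlgebra 2))
            (col : I.H →ₗ[IwasawaAlgebra 2] P) (j : P →ₗ[IwasawaAlgebra 2] D.X)
            (k : D.X →ₗ[IwasawaAlgebra 2] Y.X) (s : I.H),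
            (∀ x, j (col x) = 0) ∧ LinearMap.ker k ≤ LinearMap.range j ∧
            Kato2004.IsEulerSystemClassTwo W hκ I s ∧ s ≠ 0 ∧
            lengthAt (IwasawaAlgebra 2) (IwasawaAlgebra 2 ⧸ Ideal.span {(P.subtype (col s))}) 𝔭 ≤
              lengthAt (IwasawaAlgebra 2) (IwasawaAlgebra 2 ⧸ Ideal.span {kobayashiL 1 Lplus Lminus}) 𝔭) :
    SignedKatoDivisibilityUpToAtTwo := by
  refine signedKatoDivisibilityUpToAtTwo_of_offTwo
    (offTwo_of_colemanLengthTwo_of_katoBoundTwo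
      (fun W _ _ hcm hr hss ha κ γ hκ hγ hcv _ f hf ϖ hϖ Lplus Lminus hPP D _ _ _ hX 𝔭 h𝔭 hp𝔭 ↦ ?_)
      (stub_katoBoundTwo_of_thm13_4_two h134))
  obtain ⟨I, Y, P, col, j, k, s, hcj, hjk, hES, hs0, hdiv⟩ :=
    hW W hcm hr hss ha κ γ hκ hγ hcv f hf ϖ hϖ Lplus Lminus hPP D hX 𝔭 h𝔭 hp𝔭
  have hL : kobayashiL 1 Lplus Lminus ≠ 0 := by rw [kobayashiL, if_pos rfl]; exact hPP.2.1
  have hcs := ne_zero_of_lengthAt_quotient_span_le hL 𝔭 h𝔭 hdiv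
  have hinj := injective_col_of_gzk h17 hr hκ hγ I col hcs
  exact ⟨I, Y, s, (Kato2004.isEulerSystemClassTwo_iff W hκ I s).mp hES, hs0,
    lengthAt_quotient_span_ne_top_of_gzk h17 hr hκ hγ I hs0 𝔭 (le_of_eq h𝔭),
    (fourTerm_lengthAt_le_of_comp_eq_zero P.subtype P.injective_subtype col hinj j k hcj hjk s 𝔭).trans
      (add_le_add le_rfl hdiv)⟩

end SignedKatoOffTwo

end Summit.BirchSwinnertonDyer.BirchSwinnertonDyer.Theorems

end
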